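import Literature.AlgebraicGeometry.Motives.MixedHodgeStructureInternalHomEvaluation
import HarnessLib

/-!
# Associativity of the tensor product of mixed Hodge structures

For mixed `ℚ`-Hodge structures `H₁`, `H₂`, `H₃` on finite-dimensional spaces, the reassociation
`(V ⊗ V') ⊗ V'' ≅ V ⊗ (V' ⊗ V'')` (Mathlib's `TensorProduct.assoc`) is an isomorphism of mixed Hodge
structures **`(H₁ ⊗ H₂) ⊗ H₃ ≅ H₁ ⊗ (H₂ ⊗ H₃)`** for the tree's `MixedHodgeStructure.tensor`
(`W_r = Σ_{i+j=r} W_i ⊗ W_j`, `F^p = Σ_{a+b=p} F^a ⊗ F^b`; El Zein–Lê, Ch. 3 of Cattani–El Zein–Griffiths–Lê,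
§3.2.2.7 (1); Deligne, *Hodge II*, 1.1.12, where the filtration of an `n`-fold tensor product
`F^p(⊗ A_i) = Σ_{Σ k_i = p} Im(⊗ F^{k_i} A_i)` is defined at once for all `n` and "ces constructions
sont compatibles à la composition des foncteurs" — both bracketings of `H₁ ⊗ H₂ ⊗ H₃` carry
`Σ_{a+b+c} W_a ⊗ W_b ⊗ W_c`, `Σ F^a ⊗ F^b ⊗ F^c`; Deligne–Milne, *Tannakian categories*, §1: the
associativity constraint of a tensor category is "the usual" one on the underlying vector spaces).

The proof goes through the tensor–Hom adjunction of `Motives/MixedHodgeStructureInternalHomEvaluation`: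
the reassociation is the double uncurrying `ev ∘ (ev ∘ (g ⊗ id) ⊗ id)` of the map
`g : H₁ → Hom(H₂, Hom(H₃, H₁ ⊗ (H₂ ⊗ H₃)))`, `v ↦ v' ↦ v'' ↦ v ⊗ (v' ⊗ v'')`, and `g` is a morphism by
the pointwise description of the filtrations of the internal Hom
(`Motives/MixedHodgeStructureInternalHomFiltrations`): `W_k ⊗ (W_n ⊗ W_m) ⊆ W_{k+n+m}` and
`F^a ⊗ (F^c ⊗ F^e) ⊆ F^{a+c+e}`. The inverse is a morphism by the strictness of morphisms of MHS
(`Hom.inverse`, El Zein–Lê Thm. 3.2.18).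

## Main results (definitions with bodies and theorems; no named facts)

* `tensorAssocCurry` — `g` above, a morphism `H₁ → Hom(H₂, Hom(H₃, H₁ ⊗ (H₂ ⊗ H₃)))`;
* **`tensorAssoc H₁ H₂ H₃ : Hom ((H₁ ⊗ H₂) ⊗ H₃) (H₁ ⊗ (H₂ ⊗ H₃))`**, `tensorAssoc_toLinearMap`
  (`= TensorProduct.assoc`), `tensorAssoc_bijective`, **`tensorAssocInv`**, the two composites are
  identities.

## References

* [DeligneHodgeII1971] P. Deligne, Théorie de Hodge II, 1.1.12.
* [CattaniElZeinGriffithsLe2014] E. Cattani et al. (eds.), Hodge Theory (2014), Ch. 3 §3.2.2.7 (1),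
  Thm. 3.2.18.
* [DeligneMilne1982Tannakian] P. Deligne, J. S. Milne, Tannakian categories, LNM 900, §1 (tensor
  categories: the associativity constraint; Def. 1.6).
-/

noncomputable section

open scoped TensorProduct

namespace Literature.AlgebraicGeometry.Motives

namespace MixedHodgeStructure

universe u v w

variable {V : Type u} [AddCommGroup V] [Module ℚ V]
variable {V' : Type v} [AddCommGroup V'] [Module ℚ V']
variable {V'' : Type w} [AddCommGroup V''] [Module ℚ V'']

open Module
open HodgeStructure (homBaseChange homBaseChange_tmul tensorBaseChange tensorBaseChange_tmul)

/-! ### Linear algebra: the reassociation `ℂ ⊗ (V ⊗ W) ≃ V_ℂ ⊗ W_ℂ` on pure tensors -/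

/-- `tensorBaseChange⁻¹ ((c ⊗ v) ⊗ (d ⊗ w)) = (c d) ⊗ (v ⊗ w)`. [folklore] -/
private theorem tensorBaseChange_symm_tmul_tmul {A : Type*} [AddCommGroup A] [Module ℚ A]
    {B : Type*} [AddCommGroup B] [Module ℚ B] (c d : ℂ) (a : A) (b : B) :
    (tensorBaseChange A B).symm ((c ⊗ₜ[ℚ] a) ⊗ₜ[ℂ] (d ⊗ₜ[ℚ] b)) = (c * d) ⊗ₜ[ℚ] (a ⊗ₜ[ℚ] b) := by
  rw [LinearEquiv.symm_apply_eq, tensorBaseChange_tmul,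
    show (d ⊗ₜ[ℚ] b : ℂ ⊗[ℚ] B) = d • ((1 : ℂ) ⊗ₜ[ℚ] b) by
      rw [TensorProduct.smul_tmul', smul_eq_mul, mul_one],
    TensorProduct.tmul_smul, TensorProduct.smul_tmul', TensorProduct.smul_tmul', smul_eq_mul, mul_comm]

/-- The triple reassociation map `v ↦ v' ↦ v'' ↦ v ⊗ (v' ⊗ v'')` (the double currying of
`TensorProduct.assoc`). [folklore] -/
private def assocCurry (V : Type u) (V' : Type v) (V'' : Type w) [AddCommGroup V] [Module ℚ V]
    [AddCommGroup V'] [Module ℚ V'] [AddCommGroup V''] [Module ℚ V''] :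
    V →ₗ[ℚ] V' →ₗ[ℚ] V'' →ₗ[ℚ] V ⊗[ℚ] (V' ⊗[ℚ] V'') :=
  TensorProduct.curry (TensorProduct.curry
    (TensorProduct.assoc ℚ V V' V'' : (V ⊗[ℚ] V') ⊗[ℚ] V'' →ₗ[ℚ] V ⊗[ℚ] (V' ⊗[ℚ] V'')))

/-- `assocCurry v v' v'' = v ⊗ (v' ⊗ v'')`. [folklore] -/
private theorem assocCurry_apply (v : V) (v' : V') (v'' : V'') :
    assocCurry V V' V'' v v' v'' = v ⊗ₜ[ℚ] (v' ⊗ₜ[ℚ] v'') :=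
  rfl

/-- The double complexified evaluation of `assocCurry`: for `τ ∈ V_ℂ`, `y ∈ V'_ℂ`, `z ∈ V''_ℂ`,
`hBC(hBC((assocCurry)_ℂ τ) y) z = tBC⁻¹ (τ ⊗ tBC⁻¹ (y ⊗ z))` (on `c ⊗ v`, `d ⊗ v'`, `e ⊗ v''` both sides
are `(c d e) ⊗ (v ⊗ (v' ⊗ v''))`). [folklore] -/
private theorem homBaseChange_homBaseChange_assocCurry (τ : ℂ ⊗[ℚ] V) (y : ℂ ⊗[ℚ] V') (z : ℂ ⊗[ℚ] V'') :
    homBaseChange V'' (V ⊗[ℚ] (V' ⊗[ℚ] V''))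
        (homBaseChange V' (V'' →ₗ[ℚ] V ⊗[ℚ] (V' ⊗[ℚ] V'')) ((assocCurry V V' V'').baseChange ℂ τ) y) z =
      (tensorBaseChange V (V' ⊗[ℚ] V'')).symm (τ ⊗ₜ[ℂ] (tensorBaseChange V' V'').symm (y ⊗ₜ[ℂ] z)) := by
  induction τ using TensorProduct.induction_on with
  | zero => simp only [map_zero, LinearMap.zero_apply, TensorProduct.zero_tmul]
  | add τ₁ τ₂ h₁ h₂ => simp only [map_add, LinearMap.add_apply, TensorProduct.add_tmul, h₁, h₂]
  | tmul c v =>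
    induction y using TensorProduct.induction_on with
    | zero => simp only [map_zero, LinearMap.zero_apply, TensorProduct.zero_tmul, TensorProduct.tmul_zero]
    | add y₁ y₂ h₁ h₂ =>
      simp only [map_add, LinearMap.add_apply, TensorProduct.add_tmul, TensorProduct.tmul_add, h₁, h₂]
    | tmul d v' =>
      induction z using TensorProduct.induction_on with
      | zero => simp only [map_zero, TensorProduct.tmul_zero]
      | add z₁ z₂ h₁ h₂ => simp only [map_add, TensorProduct.tmul_add, h₁, h₂]
      | tmul e v'' =>
        rw [LinearMap.baseChange_tmul, homBaseChange_tmul, LinearMap.smul_apply, LinearMap.baseChange_tmul,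
          TensorProduct.smul_tmul', smul_eq_mul, homBaseChange_tmul, LinearMap.smul_apply,
          LinearMap.baseChange_tmul, assocCurry_apply, TensorProduct.smul_tmul', smul_eq_mul,
          tensorBaseChange_symm_tmul_tmul, tensorBaseChange_symm_tmul_tmul, mul_assoc]

variable [FiniteDimensional ℚ V] [FiniteDimensional ℚ V'] [FiniteDimensional ℚ V'']
  (H₁ : MixedHodgeStructure V) (H₂ : MixedHodgeStructure V') (H₃ : MixedHodgeStructure V'')

/-! ### The reassociation as a morphism -/

/-- **`v ↦ v' ↦ v'' ↦ v ⊗ (v' ⊗ v'')` is a morphism `H₁ → Hom(H₂, Hom(H₃, H₁ ⊗ (H₂ ⊗ H₃)))`**: for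
`v ∈ W_k`, `v' ∈ W_n`, `v'' ∈ W_m` the tensor `v ⊗ (v' ⊗ v'')` lies in
`W_k ⊗ (W_n ⊗ W_m) ⊆ W_{m+n+k}(H₁ ⊗ (H₂ ⊗ H₃))`, and likewise `F^a ⊗ (F^c ⊗ F^e) ⊆ F^{e+c+a}` — by the
pointwise description of `W` and `F` of the internal Hom (`mem_hom_W_iff`, `mem_hom_F_iff`; Deligne,
Hodge II, 1.1.12). [cite: DeligneHodgeII1971, 1.1.12] [cite: CattaniElZeinGriffithsLe2014, Ch. 3 §3.2.2.7] -/
def tensorAssocCurry : Hom H₁ (hom H₂ (hom H₃ (tensor H₁ (tensor H₂ H₃)))) where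
  toLinearMap := assocCurry V V' V''
  map_W_le k := by
    rintro _ ⟨v, hv, rfl⟩
    rw [mem_hom_W_iff]
    rintro n _ ⟨v', hv', rfl⟩
    rw [mem_hom_W_iff]
    rintro m _ ⟨v'', hv'', rfl⟩
    rw [assocCurry_apply, tensor_W]
    refine Submodule.mem_iSup_of_mem (k, n + m) (Submodule.mem_iSup_of_mem
      (show k + (n + m) = m + (n + k) by ring) (Submodule.apply_mem_map₂ _ hv ?_))
    rw [tensor_W]
    exact Submodule.mem_iSup_of_mem (n, m) (Submodule.mem_iSup_of_mem rfl
      (Submodule.apply_mem_map₂ _ hv' hv''))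
  map_F_le a := by
    rintro _ ⟨τ, hτ, rfl⟩
    rw [mem_hom_F_iff]
    rintro c _ ⟨y, hy, rfl⟩
    rw [mem_hom_F_iff]
    rintro e _ ⟨z, hz, rfl⟩
    rw [homBaseChange_homBaseChange_assocCurry, tensor_F]
    refine Submodule.mem_iSup_of_mem (a, c + e) (Submodule.mem_iSup_of_mem
      (show a + (c + e) = e + (c + a) by ring) ?_)
    rw [Submodule.mem_comap, LinearEquiv.coe_coe, LinearEquiv.apply_symm_apply]
    refine Submodule.apply_mem_map₂ _ hτ ?_
    rw [tensor_F]
    refine Submodule.mem_iSup_of_mem (c, e) (Submodule.mem_iSup_of_mem rfl ?_)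
    rw [Submodule.mem_comap, LinearEquiv.coe_coe, LinearEquiv.apply_symm_apply]
    exact Submodule.apply_mem_map₂ _ hy hz

/-- The underlying map of `tensorAssocCurry`. [cite: DeligneHodgeII1971, 1.1.12] -/
@[simp]
theorem tensorAssocCurry_toLinearMap_apply (v : V) (v' : V') (v'' : V'') :
    (tensorAssocCurry H₁ H₂ H₃).toLinearMap v v' v'' = v ⊗ₜ[ℚ] (v' ⊗ₜ[ℚ] v'') :=
  rfl

/-- **The associativity isomorphism `(H₁ ⊗ H₂) ⊗ H₃ → H₁ ⊗ (H₂ ⊗ H₃)`,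
`(v ⊗ v') ⊗ v'' ↦ v ⊗ (v' ⊗ v'')`, is a morphism of mixed Hodge structures** — the double
uncurrying of `tensorAssocCurry` along the tensor–Hom adjunction (`uncurryHom`; Deligne–Milne
Def. 1.6); El Zein–Lê §3.2.2.7 (1), Deligne, Hodge II, 1.1.12 (the filtrations of a triple tensor
product do not depend on the bracketing). [cite: DeligneHodgeII1971, 1.1.12]
[cite: CattaniElZeinGriffithsLe2014, Ch. 3 §3.2.2.7] [cite: DeligneMilne1982Tannakian, §1 Def. 1.6] -/
def tensorAssoc : Hom (tensor (tensor H₁ H₂) H₃) (tensor H₁ (tensor H₂ H₃)) :=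
  uncurryHom H₃ (tensor H₁ (tensor H₂ H₃)) (uncurryHom H₂ (hom H₃ (tensor H₁ (tensor H₂ H₃)))
    (tensorAssocCurry H₁ H₂ H₃))

/-- The underlying map of `tensorAssoc` is Mathlib's `TensorProduct.assoc`.
[cite: CattaniElZeinGriffithsLe2014, Ch. 3 §3.2.2.7] -/
@[simp]
theorem tensorAssoc_toLinearMap :
    (tensorAssoc H₁ H₂ H₃).toLinearMap =
      (TensorProduct.assoc ℚ V V' V'' : (V ⊗[ℚ] V') ⊗[ℚ] V'' →ₗ[ℚ] V ⊗[ℚ] (V' ⊗[ℚ] V'')) :=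
  TensorProduct.ext_threefold fun _ _ _ ↦ rfl

/-- `tensorAssoc ((v ⊗ v') ⊗ v'') = v ⊗ (v' ⊗ v'')`. [cite: CattaniElZeinGriffithsLe2014, Ch. 3 §3.2.2.7] -/
theorem tensorAssoc_apply_tmul (v : V) (v' : V') (v'' : V'') :
    (tensorAssoc H₁ H₂ H₃).toLinearMap ((v ⊗ₜ[ℚ] v') ⊗ₜ[ℚ] v'') = v ⊗ₜ[ℚ] (v' ⊗ₜ[ℚ] v'') :=
  rfl

/-- `tensorAssoc` is bijective. [cite: CattaniElZeinGriffithsLe2014, Ch. 3 §3.2.2.7 and Thm. 3.2.18] -/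
theorem tensorAssoc_bijective : Function.Bijective (tensorAssoc H₁ H₂ H₃).toLinearMap := by
  rw [tensorAssoc_toLinearMap]
  exact (TensorProduct.assoc ℚ V V' V'').bijective

/-- **The inverse associativity isomorphism `H₁ ⊗ (H₂ ⊗ H₃) → (H₁ ⊗ H₂) ⊗ H₃`** — a morphism of MHS as
the inverse of the bijective morphism `tensorAssoc` (strictness: El Zein–Lê Thm. 3.2.18, the tree's
`Hom.inverse`). [cite: CattaniElZeinGriffithsLe2014, Ch. 3 §3.2.2.7 and Thm. 3.2.18] -/
def tensorAssocInv : Hom (tensor H₁ (tensor H₂ H₃)) (tensor (tensor H₁ H₂) H₃) :=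
  (tensorAssoc H₁ H₂ H₃).inverse (tensorAssoc_bijective H₁ H₂ H₃)

/-- `tensorAssocInv ∘ tensorAssoc = id`. [cite: CattaniElZeinGriffithsLe2014, Thm. 3.2.18] -/
theorem tensorAssocInv_comp_tensorAssoc :
    (tensorAssocInv H₁ H₂ H₃).comp (tensorAssoc H₁ H₂ H₃) = Hom.id _ :=
  Hom.inverse_comp _ _

/-- `tensorAssoc ∘ tensorAssocInv = id`. [cite: CattaniElZeinGriffithsLe2014, Thm. 3.2.18] -/
theorem tensorAssoc_comp_tensorAssocInv :
    (tensorAssoc H₁ H₂ H₃).comp (tensorAssocInv H₁ H₂ H₃) = Hom.id _ :=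
  Hom.comp_inverse _ _

/-- The underlying map of `tensorAssocInv` is `TensorProduct.assoc⁻¹`:
`v ⊗ (v' ⊗ v'') ↦ (v ⊗ v') ⊗ v''`. [cite: CattaniElZeinGriffithsLe2014, Ch. 3 §3.2.2.7] -/
theorem tensorAssocInv_apply_tmul (v : V) (v' : V') (v'' : V'') :
    (tensorAssocInv H₁ H₂ H₃).toLinearMap (v ⊗ₜ[ℚ] (v' ⊗ₜ[ℚ] v'')) = (v ⊗ₜ[ℚ] v') ⊗ₜ[ℚ] v'' := by
  have h := congrArg (fun φ : Hom _ _ ↦ φ.toLinearMap ((v ⊗ₜ[ℚ] v') ⊗ₜ[ℚ] v''))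
    (tensorAssocInv_comp_tensorAssoc H₁ H₂ H₃)
  simpa only [Hom.comp_toLinearMap, LinearMap.comp_apply, tensorAssoc_apply_tmul,
    Hom.id_toLinearMap, LinearMap.id_apply] using h

/-- **Weights and Hodge numbers are insensitive to the bracketing**:
`h^{p,q}((H₁ ⊗ H₂) ⊗ H₃) = h^{p,q}(H₁ ⊗ (H₂ ⊗ H₃))`. [cite: CattaniElZeinGriffithsLe2014, Ch. 3 §3.2.2.7] -/
theorem hodgeNumber_tensor_assoc (p q : ℤ) :
    (tensor (tensor H₁ H₂) H₃).hodgeNumber p q = (tensor H₁ (tensor H₂ H₃)).hodgeNumber p q :=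
  Hom.hodgeNumber_eq_of_bijective (tensorAssoc H₁ H₂ H₃) (tensorAssoc_bijective H₁ H₂ H₃) p q

end MixedHodgeStructure

end Literature.AlgebraicGeometry.Motives

end
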